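import Summits.NavierStokesRegularity.NavierStokesRegularity.Theses.HardyPointSink
import Literature.Analysis.FluidPDE.LocalTypeILiouville
import Summits.NavierStokesRegularity.NavierStokesRegularity.Theorems.HardyPointSinkNoHardyTypeIAncientL3SeqLiouville

/-!
# Route HardyPointSink — crux `NoHardyTypeIAncient` (stmt-NavierStokesRegularity-7980), line `birth`:
# certificate — time-periodic fields with `𝐈 < ∞` have an `L³`-bounded backward sequence of slices

Summit-side proof file (certificate sub-goal of the registered skeleton
`Cruxes/NoHardyTypeIAncient/Lines/birth.lean`, lead c4). For a field `u` on `(−∞, 0) × ℝ³`,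
jointly a.e.-strongly measurable on the slab, time-periodic (`u(t − P) = u(t)`, `P > 0`) and with
finite Albritton–Barker Type-I quantity `𝐈 = typeIBound (Iio 0 ×ˢ univ) u p G`, the slices are
bounded in `L³` along a sequence of negative times tending to `−∞`: the cubic term of `𝐈` at the
cylinders `Q((0,0), √(nP))` gives `∫_{−nP}^{0} ∫_{B_{√(nP)}} |u|³ ≤ nP·𝐈`, periodicity folds the
`n` periods onto one, so `∫_{−P}^{0} ‖u(t)‖³_{L³} dt ≤ P·𝐈`, and one good slice recurs along
`t₀ − (k+1)P → −∞`. (Type-I dilution; together with the `L³` Liouville certificate of the line it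
excludes time-periodic — in particular steady — witnesses of the crux.)

## References

* D. Albritton, T. Barker, J. Math. Fluid Mech. 21 (2019) no. 43 = arXiv:1811.00502, §1 (the
  display defining `C` and `𝐈(ω)`).
-/

noncomputable section

set_option linter.dupNamespace false

open MeasureTheory Set Function Filter TopologicalSpace Metric
open scoped ENNReal NNReal Topology

namespace Summit.NavierStokesRegularity.NavierStokesRegularity.Theorems

open Literature.Analysis.FluidPDE

/-- **Certificate `hardyPointSink_cert_periodicL3`.** A time-periodic field on `(−∞, 0) × ℝ³`
(`u (t − P) = u t` for `t < 0`, some `P > 0`), jointly a.e.-strongly measurable on the slab, with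
`typeIBound (Iio 0 ×ˢ univ) u p G < ∞`, has slices bounded in `L³` along negative times
`τ_k → −∞`. [cite: AlbrittonBarker2019, §1 (display defining C and 𝐈(ω) after Thm 1.1)] -/
theorem hardyPointSink_cert_periodicL3 :
    ∀ (u : ℝ → EuclideanSpace ℝ (Fin 3) → EuclideanSpace ℝ (Fin 3))
      (p : ℝ → EuclideanSpace ℝ (Fin 3) → ℝ)
      (G : ℝ → EuclideanSpace ℝ (Fin 3) → EuclideanSpace ℝ (Fin 3) →L[ℝ] EuclideanSpace ℝ (Fin 3)),
      AEStronglyMeasurable (uncurry u)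
        (volume.restrict (Iio (0 : ℝ) ×ˢ (univ : Set (EuclideanSpace ℝ (Fin 3))))) →
      Literature.Analysis.FluidPDE.typeIBound
        (Iio (0 : ℝ) ×ˢ (univ : Set (EuclideanSpace ℝ (Fin 3)))) u p G < ⊤ →
      (∃ P : ℝ, 0 < P ∧ ∀ t < 0, u (t - P) = u t) →
      ∃ (τ : ℕ → ℝ) (M : ℝ≥0∞), M < ⊤ ∧ Tendsto τ atTop atBot ∧ (∀ k, τ k < 0) ∧
        ∀ k, eLpNorm (u (τ k)) 3 volume ≤ M := by
  intro u p G hjoint hI hper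
  obtain ⟨P, hP, hper⟩ := hper
  set I : ℝ≥0∞ := Literature.Analysis.FluidPDE.typeIBound
    (Iio (0 : ℝ) ×ˢ (univ : Set (EuclideanSpace ℝ (Fin 3)))) u p G with hIdef
  -- the cubic integrand
  set f : ℝ × EuclideanSpace ℝ (Fin 3) → ℝ≥0∞ := fun q => ‖u q.1 q.2‖ₑ ^ (3 : ℕ) with hfdef
  /- Step 1: the cubic term of `𝐈` on the origin-centred cylinders:
     `∫∫_{Q_r(0,0)} |u|³ ≤ r² 𝐈`. -/
  have hcyl : ∀ r : ℝ, 0 < r →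
      ∫⁻ q in parabolicCylinder r ((0 : ℝ), (0 : EuclideanSpace ℝ (Fin 3))), f q ≤
        ENNReal.ofReal r ^ 2 * I := by
    intro r hr
    have hC : cknC r ((0 : ℝ), (0 : EuclideanSpace ℝ (Fin 3))) u ≤ I :=
      calc cknC r ((0 : ℝ), (0 : EuclideanSpace ℝ (Fin 3))) u
          ≤ abScaledSum r ((0 : ℝ), (0 : EuclideanSpace ℝ (Fin 3))) u p G :=
            le_add_right (le_add_right le_add_self)
        _ ≤ I := abScaledSum_le_typeIBound hr (parabolicCylinder_origin_subset_slab r)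
    unfold cknC at hC
    have hb0 : ENNReal.ofReal r ^ 2 ≠ 0 := pow_ne_zero _ (ENNReal.ofReal_pos.2 hr).ne'
    have hbtop : ENNReal.ofReal r ^ 2 ≠ ⊤ := ENNReal.pow_ne_top ENNReal.ofReal_ne_top
    calc ∫⁻ q in parabolicCylinder r ((0 : ℝ), (0 : EuclideanSpace ℝ (Fin 3))), f q
        = ENNReal.ofReal r ^ 2 * ((ENNReal.ofReal r ^ 2)⁻¹ *
            ∫⁻ q in parabolicCylinder r ((0 : ℝ), (0 : EuclideanSpace ℝ (Fin 3))), f q) := by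
          rw [← mul_assoc, ENNReal.mul_inv_cancel hb0 hbtop, one_mul]
      _ ≤ ENNReal.ofReal r ^ 2 * I := by gcongr
  /- Step 2: iterated periodicity `u (t - j P) = u t` for `t < 0`. -/
  have hperj : ∀ (j : ℕ) (t : ℝ), t < 0 → u (t - (j : ℝ) * P) = u t := by
    intro j
    induction j with
    | zero => intro t _; simp
    | succ j ih =>
        intro t ht
        have hjP : 0 ≤ (j : ℝ) * P := mul_nonneg j.cast_nonneg hP.le
        have e : t - ((j + 1 : ℕ) : ℝ) * P = (t - P) - (j : ℝ) * P := by push_cast; ring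
        rw [e, ih (t - P) (by linarith), hper t ht]
  /- Step 3: one period carries at most `P 𝐈` of the cubic integral on every ball:
     `Φ_R := ∫_{(-P,0) × B_R} |u|³ ≤ P 𝐈` whenever `R² = n P`, `n ≥ 1`. -/
  have hperiod : ∀ n : ℕ, 1 ≤ n →
      ∫⁻ q in Ioo (-P) 0 ×ˢ ball (0 : EuclideanSpace ℝ (Fin 3)) (Real.sqrt (n * P)), f q ≤
        ENNReal.ofReal P * I := by
    intro n hn
    set R : ℝ := Real.sqrt (n * P) with hRdef
    have hnP : 0 < (n : ℝ) * P := mul_pos (by exact_mod_cast hn) hP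
    have hRpos : 0 < R := Real.sqrt_pos.2 hnP
    have hRsq : R ^ 2 = n * P := Real.sq_sqrt hnP.le
    -- the shifted period slabs
    set A : ℕ → Set (ℝ × EuclideanSpace ℝ (Fin 3)) :=
      fun j => Ioo (-((j : ℝ) + 1) * P) (-(j : ℝ) * P) ×ˢ ball (0 : EuclideanSpace ℝ (Fin 3)) R
      with hAdef
    have hAmeas : ∀ j, MeasurableSet (A j) := fun j => measurableSet_Ioo.prod measurableSet_ball
    -- each has the same integral as the first one (time translation + periodicity)
    have hAeq : ∀ j : ℕ, ∫⁻ q in A j, f q = ∫⁻ q in A 0, f q := by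
      intro j
      set g : ℝ × EuclideanSpace ℝ (Fin 3) → ℝ × EuclideanSpace ℝ (Fin 3) :=
        fun q => (q.1 + (j : ℝ) * P, q.2) with hgdef
      have hge : MeasurableEmbedding g :=
        ((MeasurableEquiv.addRight ((j : ℝ) * P)).prodCongr
          (MeasurableEquiv.refl (EuclideanSpace ℝ (Fin 3)))).measurableEmbedding
      have hgmp : MeasurePreserving g (volume : Measure (ℝ × EuclideanSpace ℝ (Fin 3))) volume := by
        have h := (measurePreserving_add_right (volume : Measure ℝ) ((j : ℝ) * P)).prod
          (MeasurePreserving.id (volume : Measure (EuclideanSpace ℝ (Fin 3))))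
        rw [← Measure.volume_eq_prod] at h
        exact h
      have hpre : g ⁻¹' (A 0) = A j := by
        ext q
        simp only [hAdef, hgdef, mem_preimage, mem_prod, mem_Ioo, Nat.cast_zero, zero_add, neg_zero,
          zero_mul]
        constructor
        · rintro ⟨⟨h1, h2⟩, h3⟩
          exact ⟨⟨by linarith, by linarith⟩, h3⟩
        · rintro ⟨⟨h1, h2⟩, h3⟩
          exact ⟨⟨by linarith, by linarith⟩, h3⟩
      have key := hgmp.setLIntegral_comp_preimage_emb hge f (A 0)
      rw [hpre] at key
      rw [← key]
      refine setLIntegral_congr_fun (hAmeas j) (fun q hq => ?_)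
      -- on `A j`, `f (g q) = f q` by periodicity
      simp only [hAdef, mem_prod, mem_Ioo] at hq
      have hq0 : q.1 + (j : ℝ) * P < 0 := by
        have := hq.1.2
        linarith
      simp only [hfdef, hgdef]
      rw [← hperj j (q.1 + (j : ℝ) * P) hq0, add_sub_cancel_right]
    -- pairwise disjoint, inside the cylinder `Q_R(0,0)`
    have hdisj : Set.PairwiseDisjoint (↑(Finset.range n)) A := by
      intro i _ j _ hij
      change Disjoint (A i) (A j)
      rw [Set.disjoint_left]
      rintro q ⟨⟨hi1, hi2⟩, -⟩ ⟨⟨hj1, hj2⟩, -⟩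
      rcases Nat.lt_or_gt_of_ne hij with h | h
      · have h' : (i : ℝ) + 1 ≤ j := by exact_mod_cast Nat.succ_le_of_lt h
        nlinarith
      · have h' : (j : ℝ) + 1 ≤ i := by exact_mod_cast Nat.succ_le_of_lt h
        nlinarith
    have hsub : (⋃ j ∈ Finset.range n, A j) ⊆
        parabolicCylinder R ((0 : ℝ), (0 : EuclideanSpace ℝ (Fin 3))) := by
      intro q hq
      simp only [mem_iUnion, Finset.mem_range, exists_prop] at hq
      obtain ⟨j, hj, hqj⟩ := hq
      simp only [hAdef, mem_prod, mem_Ioo] at hqj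
      rw [mem_parabolicCylinder]
      have hj' : (j : ℝ) + 1 ≤ n := by exact_mod_cast Nat.succ_le_of_lt hj
      have hj0 : 0 ≤ (j : ℝ) * P := mul_nonneg j.cast_nonneg hP.le
      refine ⟨⟨?_, ?_⟩, ?_⟩
      · rw [hRsq]; nlinarith [hqj.1.1]
      · nlinarith [hqj.1.2]
      · simpa [dist_zero_right] using hqj.2
    -- sum up
    have hsum : (n : ℝ≥0∞) * ∫⁻ q in A 0, f q ≤ ENNReal.ofReal ((n : ℝ) * P) * I :=
      calc (n : ℝ≥0∞) * ∫⁻ q in A 0, f q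
          = ∑ j ∈ Finset.range n, ∫⁻ q in A j, f q := by
            rw [Finset.sum_congr rfl fun j _ => hAeq j, Finset.sum_const, Finset.card_range,
              nsmul_eq_mul]
        _ = ∫⁻ q in ⋃ j ∈ Finset.range n, A j, f q :=
            (lintegral_biUnion_finset hdisj (fun j _ => hAmeas j) f).symm
        _ ≤ ∫⁻ q in parabolicCylinder R ((0 : ℝ), (0 : EuclideanSpace ℝ (Fin 3))), f q :=
            lintegral_mono_set hsub
        _ ≤ ENNReal.ofReal R ^ 2 * I := hcyl R hRpos
        _ = ENNReal.ofReal ((n : ℝ) * P) * I := by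
            rw [← ENNReal.ofReal_pow hRpos.le, hRsq]
    have hA0 : A 0 = Ioo (-P) 0 ×ˢ ball (0 : EuclideanSpace ℝ (Fin 3)) R := by
      simp [hAdef]
    rw [← hA0]
    have hn0 : (n : ℝ≥0∞) ≠ 0 := by exact_mod_cast (Nat.one_le_iff_ne_zero.1 hn)
    have hntop : (n : ℝ≥0∞) ≠ ⊤ := ENNReal.natCast_ne_top n
    rw [ENNReal.ofReal_mul (Nat.cast_nonneg n), ENNReal.ofReal_natCast, mul_assoc] at hsum
    exact (ENNReal.mul_le_mul_iff_right hn0 hntop).1 hsum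
  /- Step 4: exhaust space: `∫_{(-P,0) × ℝ³} |u|³ ≤ P 𝐈`. -/
  have hslab : ∫⁻ q in Ioo (-P) 0 ×ˢ (univ : Set (EuclideanSpace ℝ (Fin 3))), f q ≤
      ENNReal.ofReal P * I := by
    set B : ℕ → Set (ℝ × EuclideanSpace ℝ (Fin 3)) :=
      fun n => Ioo (-P) 0 ×ˢ ball (0 : EuclideanSpace ℝ (Fin 3)) (Real.sqrt (((n : ℝ) + 1) * P))
      with hBdef
    have hmono : Monotone B := by
      intro m n hmn
      refine prod_mono le_rfl (ball_subset_ball ?_)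
      exact Real.sqrt_le_sqrt (by
        have : (m : ℝ) ≤ n := Nat.cast_le.2 hmn
        nlinarith [hP])
    have hunion : Ioo (-P) 0 ×ˢ (univ : Set (EuclideanSpace ℝ (Fin 3))) = ⋃ n, B n := by
      ext q
      simp only [hBdef, mem_prod, mem_univ, and_true, mem_iUnion, mem_ball, dist_zero_right]
      constructor
      · intro hq
        obtain ⟨n, hn⟩ := exists_nat_gt (‖q.2‖ ^ 2 / P)
        refine ⟨n, hq, ?_⟩
        rw [Real.lt_sqrt (norm_nonneg _)]
        rw [div_lt_iff₀ hP] at hn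
        nlinarith
      · rintro ⟨n, hq, -⟩
        exact hq
    rw [hunion, setLIntegral_iUnion_of_directed _ hmono.directed_le]
    refine iSup_le fun n => ?_
    have h := hperiod (n + 1) (Nat.succ_le_succ (Nat.zero_le n))
    push_cast at h
    exact h
  /- Step 5: Tonelli — one good slice in the period. -/
  have hsubslab : Ioo (-P) 0 ×ˢ (univ : Set (EuclideanSpace ℝ (Fin 3))) ⊆
      Iio (0 : ℝ) ×ˢ (univ : Set (EuclideanSpace ℝ (Fin 3))) :=
    prod_mono (fun t ht => ht.2) le_rfl
  have hfm0 : AEMeasurable f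
      (volume.restrict (Ioo (-P) 0 ×ˢ (univ : Set (EuclideanSpace ℝ (Fin 3))))) :=
    ((hjoint.mono_measure (Measure.restrict_mono hsubslab le_rfl)).aemeasurable.enorm.pow_const _)
  have hprod : (volume.restrict (Ioo (-P) 0 ×ˢ (univ : Set (EuclideanSpace ℝ (Fin 3)))) :
      Measure (ℝ × EuclideanSpace ℝ (Fin 3))) =
      ((volume : Measure ℝ).restrict (Ioo (-P) 0)).prod (volume : Measure (EuclideanSpace ℝ (Fin 3))) := by
    rw [← Measure.restrict_univ (μ := (volume : Measure (EuclideanSpace ℝ (Fin 3)))),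
      Measure.prod_restrict, ← Measure.volume_eq_prod]
  have hfm : AEMeasurable f
      (((volume : Measure ℝ).restrict (Ioo (-P) 0)).prod (volume : Measure (EuclideanSpace ℝ (Fin 3)))) := by
    rw [← hprod]; exact hfm0
  have htonelli : ∫⁻ q in Ioo (-P) 0 ×ˢ (univ : Set (EuclideanSpace ℝ (Fin 3))), f q =
      ∫⁻ t in Ioo (-P) 0, ∫⁻ x, ‖u t x‖ₑ ^ (3 : ℕ) := by
    rw [hprod, lintegral_prod _ hfm]
  have hΨm : AEMeasurable (fun t => ∫⁻ x, ‖u t x‖ₑ ^ (3 : ℕ))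
      ((volume : Measure ℝ).restrict (Ioo (-P) 0)) := hfm.lintegral_prod_right'
  have hΨint : ∫⁻ t in Ioo (-P) 0, ∫⁻ x, ‖u t x‖ₑ ^ (3 : ℕ) ≠ ⊤ := by
    rw [← htonelli]
    exact (lt_of_le_of_lt hslab (ENNReal.mul_lt_top ENNReal.ofReal_lt_top hI)).ne
  have hae : ∀ᵐ t ∂((volume : Measure ℝ).restrict (Ioo (-P) 0)), ∫⁻ x, ‖u t x‖ₑ ^ (3 : ℕ) < ⊤ :=
    ae_lt_top' hΨm hΨint
  haveI : (ae ((volume : Measure ℝ).restrict (Ioo (-P) 0))).NeBot := by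
    rw [ae_neBot, Ne, Measure.restrict_eq_zero, Real.volume_Ioo, ENNReal.ofReal_eq_zero, not_le]
    linarith
  obtain ⟨t₀, ht₀Ψ, ht₀mem⟩ := (hae.and (ae_restrict_mem measurableSet_Ioo)).exists
  have ht₀neg : t₀ < 0 := ht₀mem.2
  /- Step 6: the good slice recurs along `t₀ - (k+1) P → -∞`. -/
  have hM : eLpNorm (u t₀) 3 volume < ⊤ := by
    rw [eLpNorm_lt_top_iff_lintegral_rpow_enorm_lt_top (by norm_num) (by norm_num)]
    have e3 : (3 : ℝ≥0∞).toReal = ((3 : ℕ) : ℝ) := by norm_num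
    rw [e3]
    simpa only [ENNReal.rpow_natCast] using ht₀Ψ
  refine ⟨fun k => t₀ - ((k : ℝ) + 1) * P, eLpNorm (u t₀) 3 volume, hM, ?_, fun k => ?_, fun k => ?_⟩
  · have hg : Tendsto (fun k : ℕ => ((k : ℝ) + 1) * P) atTop atTop :=
      (tendsto_atTop_add_const_right _ 1 tendsto_natCast_atTop_atTop).atTop_mul_const hP
    have := tendsto_atBot_add_const_left atTop t₀ (tendsto_neg_atTop_atBot.comp hg)
    simpa [sub_eq_add_neg, Function.comp_def] using this
  · have : 0 < ((k : ℝ) + 1) * P := by positivity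
    linarith
  · have e := hperj (k + 1) t₀ ht₀neg
    push_cast at e
    rw [e]

/-- **No time-periodic witness of the crux** (in particular no steady one): the crux
`HardyPointSink.NoHardyTypeIAncient` restricted to triples whose velocity is time-periodic on
`(−∞, 0)`. A periodic witness has an `L³`-bounded backward sequence of slices
(`hardyPointSink_cert_periodicL3`), which the unconditional `L³` Liouville certificate of the line
(`hardyPointSink_cert_L3seqLiouville`: Albritton–Barker 2019 Thm 1.2 on the Oseen representative)
turns into a.e. vanishing of a.e. slice, contradicting non-triviality on the slab.
[cite: AlbrittonBarker2019, Thm 1.2 (arXiv:1811.00502 p. 4)] -/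
theorem hardyPointSink_noHardyTypeIAncient_periodic :
    ¬ ∃ (u : ℝ → EuclideanSpace ℝ (Fin 3) → EuclideanSpace ℝ (Fin 3))
        (p : ℝ → EuclideanSpace ℝ (Fin 3) → ℝ)
        (G : ℝ → EuclideanSpace ℝ (Fin 3) → EuclideanSpace ℝ (Fin 3) →L[ℝ] EuclideanSpace ℝ (Fin 3)),
      (∀ t < 0, AEStronglyMeasurable (u t) volume) ∧
      Literature.Analysis.FluidPDE.IsBoundedAncientMildSolution 1 u ∧
      Literature.Analysis.FluidPDE.IsSuitableWeakSolutionOn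
        (Literature.Analysis.FluidPDE.slab (EuclideanSpace ℝ (Fin 3)) (Iio 0) isOpen_Iio) 1 0 u p ∧
      Literature.Analysis.FluidPDE.HasWeakSpatialGradientOn
        (Literature.Analysis.FluidPDE.slab (EuclideanSpace ℝ (Fin 3)) (Iio 0) isOpen_Iio) u G ∧
      ¬ (uncurry u =ᵐ[volume.restrict
        (Iio (0 : ℝ) ×ˢ (univ : Set (EuclideanSpace ℝ (Fin 3))))] 0) ∧
      Literature.Analysis.FluidPDE.typeIBound
        (Iio (0 : ℝ) ×ˢ (univ : Set (EuclideanSpace ℝ (Fin 3)))) u p G < ⊤ ∧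
      (∃ K : ℝ≥0, ∀ x₀ : EuclideanSpace ℝ (Fin 3), ∀ᵐ t ∂(volume.restrict (Iio (0 : ℝ))),
        ∫⁻ x, ‖u t x‖ₑ ^ 2 / ‖x - x₀‖ₑ ≤ K) ∧
      (∃ P : ℝ, 0 < P ∧ ∀ t < 0, u (t - P) = u t) := by
  rintro ⟨u, p, G, hmeas, hu, -, hG, hne, hI, hH, hper⟩
  have hjoint : AEStronglyMeasurable (uncurry u)
      (volume.restrict (Iio (0 : ℝ) ×ˢ (univ : Set (EuclideanSpace ℝ (Fin 3))))) :=
    hG.locallyIntegrableOn.aestronglyMeasurable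
  have hL3 := hardyPointSink_cert_periodicL3 u p G hjoint hI hper
  refine hne ?_
  filter_upwards [ae_eq_zero_slab_of_ae_slice hjoint
    (hardyPointSink_cert_L3seqLiouville u hmeas hjoint hu hH hL3)] with z hz
  exact hz

end Summit.NavierStokesRegularity.NavierStokesRegularity.Theorems

end
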